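import Summits.BirchSwinnertonDyer.BirchSwinnertonDyer.Theorems.EisensteinPrimesAcTwistDeformationCurveSUR
import Summits.BirchSwinnertonDyer.BirchSwinnertonDyer.Theorems.EisensteinPrimesAcTwistDeformationCurveCotorsion
import Summits.BirchSwinnertonDyer.BirchSwinnertonDyer.Theorems.EisensteinPrimesAcTwistDeformationSurOfSUR
import Summits.BirchSwinnertonDyer.BirchSwinnertonDyer.Theorems.EisensteinPrimesAcTwistDeformationResidualPair
import Summits.BirchSwinnertonDyer.BirchSwinnertonDyer.Theorems.EisensteinPrimesIndexPlumbingDictionary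
import Summits.BirchSwinnertonDyer.BirchSwinnertonDyer.Theorems.SignedBaseChangeAnticyclotomicEisensteinDivisibilityCurveModel
import Summits.BirchSwinnertonDyer.BirchSwinnertonDyer.Theorems.UniversalToricDescentSigmaLocalStabilizer
import Summits.BirchSwinnertonDyer.Rank1Residual.X11b.AnticyclotomicSelmer
import HarnessLib

/-!
# The `K_∞`-side global-to-local SURJECTIVITY for `E[p^∞]` at the TAME bad places:
# `Sel_𝔭̄^{Sf}(K_∞, E[p^∞]) ↠ ∏_{w∈Sf} ∏_{i<[Γ:Γ_w]} H¹(K_{∞,w_i}, E[p^∞])` (Castella's `Sf`-relaxed anticyclotomic Selmer group),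
# from Greenberg 2016 Prop. 2.6.3 / Greenberg 2006 Props. 3.2, 4.1, 4.2, §5 A BY NAME and the `Λ`-cotorsion of `X_ac^∅`

Route `CumulativeHeegnerLeopoldt`, crux K2-odd stmt-23970, line `birth`, stub ALG-≥(i) `stub_curveRelaxationCorankEq` (lead
`bsd-line-chl-p1` g10; helper, `--supports stmt-BirchSwinnertonDyer-23970`). Cell `bsd-eis`'s width seat w3 assembled the same
surjectivity AT `v̄` (`AcTwistDeformation.curve_exists_forall_resOfLe_conjH1_pow_eq_at_vbar`: `S₀ = {v̄}`) from its E-side twist-deformation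
arena (`𝐃_E = E[p^∞] ⊗ Λ^*(κ⁻¹)`: `primaryTorsion_fullAt_SUR`, `hasCorank_fullAtSelmer_zero_of_xAc`, the coefficient-agnostic and
place-agnostic Shapiro descent `exists_mem_unramifiedOutside_forall_resOfLe_conjH1_eq_of_SUR`). THIS FILE runs the same engine at
`S₀ = Sf` = the places over `N_E` prime to `p` (full place `v ∣ p` = Castella's relaxed place, strict place `v̄`), and reads the output
in Castella's currency through the dictionary `IndexPlumbingDictionary.datumStrictSelmer_le_selmerAc` (awayKer at `v̄` =
`strictKer` of the strict datum, `BigGaloisRep.strictKer_strictDatum_eq_awayKer`):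

**`curve_exists_forall_resOfLe_conjH1_pow_eq_tame`** — for `E = W/ℚ` base-changed to the imaginary quadratic `K` ((Heeg) for `N_E`),
`2 < p = v v̄`, `κ` anticyclotomic with topological generator `γ`, `Sf` = the places over `N_E` prime to `p`, GRANTED the five Greenberg
facts by name and `X_ac^∅(E/K_∞)` (strict at `v̄`) finitely generated `Λ`-torsion: exponents `a_w` with `κ(D_w) = p^{a_w} ℤ_p` exactly on
`Sf`, and for EVERY family of local targets `y w i ∈ H¹(ker κ ⊓ D_w, E_K[p^∞])` a class `u ∈ Sel_v̄^{Sf}(K_∞, E_K[p^∞])` with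
`res_{ker κ ⊓ D_w}(conj_{γ^i} u) = y w i` for all `w ∈ Sf`, `i < p^{a_w}` — Pollack–Weston Prop. A.2 / CGLS (eq:1) for `E[p^∞]` over
`K_∞^{ac}`, in the `∃`-form consumed by `CurveRelaxationCount.zpCorank_selmerAc_quotient_eq_sum_of_forall_exists`.

Theorems only; CONDITIONAL by name on the published facts it takes (two of which, Greenberg 2006 Prop. 4.2 and §5 A, are tree
theorems and are fed as such by the consumer) and on the `Λ`-cotorsion input; no definition, no named fact, no `sorry`; closes nothing
by itself. BSD is not proved by any of this.
References: [Greenberg2016Selmer] Prop. 2.6.3, §4.3; [Greenberg2006] Props. 3.2, 4.1, 4.2, §5 A; [PollackWeston2011] App. A Prop. A.2;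
[CastellaGrossiLeeSkinner2022] (eq:1), §1.4; [GreenbergVatsal2000] §2 Cor. (2.3), Prop. (2.4); [Castella2018] Def. 2.2.
-/

set_option autoImplicit false
-- `…BirchSwinnertonDyer.BirchSwinnertonDyer.Theorems…` is the problem's mandated namespace (D-0017).
set_option linter.dupNamespace false

noncomputable section

open scoped Classical
open NumberField IsDedekindDomain Field Multiplicative PowerSeries WeierstrassCurve
open Literature.NumberTheory.EllipticCurves Literature.NumberTheory.EllipticCurves.GreenbergSelmer
  Literature.NumberTheory.EllipticCurves.GreenbergVatsal2000 Literature.NumberTheory.GaloisRepresentations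
  Literature.NumberTheory.EllipticCurves.KellerYin2024 Literature.NumberTheory.EllipticCurves.IwasawaDual
  Literature.NumberTheory.EllipticCurves.Castella2018.AcSelmer
  Literature.NumberTheory.IwasawaTheory Literature.NumberTheory.IwasawaTheory.Greenberg2016
  Literature.NumberTheory.IwasawaTheory.Greenberg2006
  Summit.BirchSwinnertonDyer.BirchSwinnertonDyer.Theorems.GreenbergFullAtSelmer
  Summit.BirchSwinnertonDyer.BirchSwinnertonDyer.Theorems.AcTwistDeformationResidualPair
  Summit.BirchSwinnertonDyer.BirchSwinnertonDyer.Theorems.AcTwistDeformation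

namespace Summit.BirchSwinnertonDyer.BirchSwinnertonDyer.Theorems.CurveRelaxationLocSurj

variable {K : Type} [Field K] [NumberField K] {p : ℕ} [Fact p.Prime]

/-- **The `K_∞`-side global-to-local surjectivity for `E[p^∞]` at the tame bad places, `∃`-form.** See the module docstring.
[cite: Greenberg2016Selmer, Prop. 2.6.3 (c) (§2.6 p. 10), §4.3 pp. 20–21] [cite: Greenberg2006, Thm. 3 p. 342, Props. 3.2, 4.1, 4.2, §5 A]
[cite: PollackWeston2011, App. A Prop. A.2] [cite: CastellaGrossiLeeSkinner2022, §1.4 (eq:1)] [cite: Castella2018, Def. 2.2] -/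
theorem curve_exists_forall_resOfLe_conjH1_pow_eq_tame (h263 : prop263_sur_of_crk)
    (h41 : prop41_globalEulerPoincareCorank) (h42 : prop42_localEulerPoincareCorank)
    (h5A : sec5A_localH2_subsingleton_of_LOC1) (h32 : prop32_cohomology_isCofinitelyGenerated)
    (W : WeierstrassCurve ℚ) [W.IsElliptic] (hp : 2 < p) (hK : IsImaginaryQuadratic K)
    (hH : SatisfiesHeegnerHypothesis (W.conductorNorm ℤ) K)
    {v vbar : HeightOneSpectrum (𝓞 K)} (hv : ((p : ℕ) : 𝓞 K) ∈ v.asIdeal)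
    (hvbar : ((p : ℕ) : 𝓞 K) ∈ vbar.asIdeal) (hne : vbar ≠ v)
    (κ : ZpExtension K p) (hκ : κ.IsAnticyclotomic) (γ : absoluteGaloisGroup K)
    [hγ : Fact (κ.IsTopGenerator γ)]
    (Sf : Finset (HeightOneSpectrum (𝓞 K)))
    (hSf : ∀ w : HeightOneSpectrum (𝓞 K), w ∈ Sf ↔
      (((W.conductorNorm ℤ : ℤ) : 𝓞 K) ∈ w.asIdeal ∧ ((p : ℕ) : 𝓞 K) ∉ w.asIdeal))
    (hXfin : Module.Finite (IwasawaAlgebra p)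
      (XAc (W.baseChange K) p κ vbar (∅ : Set (HeightOneSpectrum (𝓞 K))) γ))
    (hXtor : Module.IsTorsion (IwasawaAlgebra p)
      (XAc (W.baseChange K) p κ vbar (∅ : Set (HeightOneSpectrum (𝓞 K))) γ)) :
    ∃ a : HeightOneSpectrum (𝓞 K) → ℕ,
      (∀ w ∈ Sf, ∀ δ ∈ decomp (K := K) w, (p : ℤ_[p]) ^ a w ∣ (κ δ).toAdd) ∧
      (∀ w ∈ Sf, ∃ δ ∈ decomp (K := K) w, (κ δ).toAdd = (p : ℤ_[p]) ^ a w) ∧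
      ∀ y : (w : HeightOneSpectrum (𝓞 K)) → ℕ →
          subgroupH1 (κ.kerSubgroup ⊓ decomp (K := K) w) ((W.baseChange K).geomPrimaryTorsion p),
        ∃ u ∈ Summit.BirchSwinnertonDyer.Rank1Residual.X11b.AcSelmer.selmerAc (W.baseChange K) p κ vbar
            (↑Sf : Set (HeightOneSpectrum (𝓞 K))),
          ∀ w ∈ Sf, ∀ i : ℕ, i < p ^ a w →
            resOfLe ((W.baseChange K).geomPrimaryTorsion p)
              (inf_le_left : κ.kerSubgroup ⊓ decomp (K := K) w ≤ κ.kerSubgroup)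
              (conjH1 κ.kerSubgroup ((W.baseChange K).geomPrimaryTorsion p) (γ ^ i) u) = y w i := by
  haveI hEK : (W.baseChange K).IsElliptic := inferInstanceAs (W.map (algebraMap ℚ K)).IsElliptic
  -- the places of `Sf` are finitely decomposed: `κ(D_w) = p^{a_w} ℤ_p` exactly
  have hdec : ∀ w ∈ Sf, ¬ decomp (K := K) w ≤ κ.kerSubgroup := fun w hw hle ↦ by
    obtain ⟨σ, hσ⟩ := exists_local_apply_ne_one_of_mem_or hK hp hH κ hκ w (Or.inr ((hSf w).mp hw).1)
    exact hσ (ZpExtension.mem_kerSubgroup.mp (hle ((mem_decomp_iff w _).mpr ⟨σ, rfl⟩)))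
  have hex : ∀ w : HeightOneSpectrum (𝓞 K), ∃ c : ℕ, w ∈ Sf →
      (∃ δ ∈ decomp (K := K) w, (κ δ).toAdd = (p : ℤ_[p]) ^ c) ∧
      (∀ δ ∈ decomp (K := K) w, (p : ℤ_[p]) ^ c ∣ (κ δ).toAdd) := by
    intro w
    by_cases hw : w ∈ Sf
    · obtain ⟨c, ⟨d₀, hd₀⟩, -, hdvd⟩ :=
        UniversalToricDescentSigmaLocalStabilizer.exists_pow_and_forall_dvd_of_not_le κ w (hdec w hw)
      exact ⟨c, fun _ ↦ ⟨⟨d₀, d₀.2, hd₀⟩, fun δ hδ ↦ hdvd ⟨δ, hδ⟩⟩⟩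
    · exact ⟨0, fun h ↦ absurd h hw⟩
  choose a ha using hex
  refine ⟨a, fun w hw ↦ (ha w hw).2, fun w hw ↦ (ha w hw).1, fun y ↦ ?_⟩
  -- `S = {v, v̄} ∪ Sf` contains the places above `p` and the bad places of `E_K`
  set S : Set (HeightOneSpectrum (𝓞 K)) := (↑(insert v (insert vbar Sf)) : Set (HeightOneSpectrum (𝓞 K)))
    with hSdef
  have hS : ∀ w : HeightOneSpectrum (𝓞 K), ((p : ℕ) : 𝓞 K) ∈ w.asIdeal → w ∈ S :=
    mem_insert_insert_of_natCast_mem hK hv hvbar hne Sf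
  have hSfS : ∀ w ∈ Sf, w ∈ S := fun w hw ↦ by
    rw [hSdef, Finset.coe_insert, Finset.coe_insert]
    exact Or.inr (Or.inr (Finset.mem_coe.mpr hw))
  have hgoodN : ∀ w : HeightOneSpectrum (𝓞 K), w ∉ Sf → ((p : ℕ) : 𝓞 K) ∉ w.asIdeal →
      (W.baseChange K).HasGoodReductionAt w := fun w hw hpw ↦
    EisensteinPrimesMuLambda.hasGoodReductionAt_baseChange_of_conductorNorm_notMem W w fun h ↦ hw ((hSf w).mpr ⟨h, hpw⟩)
  have hSbad : ∀ w : HeightOneSpectrum (𝓞 K), ¬ (W.baseChange K).HasGoodReductionAt w → w ∈ S := by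
    intro w hw
    by_cases hpw : ((p : ℕ) : 𝓞 K) ∈ w.asIdeal
    · exact hS w hpw
    · exact hSfS w (by_contra fun hw' ↦ hw (hgoodN w hw' hpw))
  have hgood : ∀ w : HeightOneSpectrum (𝓞 K), w ∉ S → ((p : ℕ) : 𝓞 K) ∉ w.asIdeal →
      (W.baseChange K).HasGoodReductionAt w := fun w hw hpw ↦ hgoodN w (fun h ↦ hw (hSfS w h)) hpw
  -- the model `ρ₀` of `E_K[p^∞]` over `G_{K,S}` (Néron–Ogg–Shafarevich)
  have hNS : ∀ n ∈ ramificationSubgroup K S, ∀ P : PrimaryTorsion (W.baseChange K).geomPoints p, n • P = P :=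
    fun n hn P ↦ SignedBaseChangeAcDivCurveModel.smul_primaryTorsion_eq_of_mem_ramificationSubgroup
      (W.baseChange K) p S hSbad hS hn P
  obtain ⟨ρ₀, hρ₀⟩ := SignedBaseChangeAcDivCurveModel.exists_continuousRep_primaryTorsion (W.baseChange K) p S hNS
  -- the canonical (discrete) topological instances of the arena
  letI tΛ : TopologicalSpace (PowerSeries ℤ_[p]) := ⊥
  haveI : DiscreteTopology (PowerSeries ℤ_[p]) := ⟨rfl⟩
  haveI : IsTopologicalRing (PowerSeries ℤ_[p]) := inferInstance
  haveI : IsTopologicalAddGroup (BigRepModule ℤ_[p] p (PrimaryTorsion (W.baseChange K).geomPoints p)) :=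
    inferInstance
  haveI : ContinuousSMul (PowerSeries ℤ_[p]) (BigRepModule ℤ_[p] p (PrimaryTorsion (W.baseChange K).geomPoints p)) :=
    inferInstance
  -- `K` imaginary quadratic
  haveI := hK.2
  have hKc : ∀ w : InfinitePlace K, w.IsComplex := IsTotallyComplex.isComplex
  -- `corank_Λ S_{𝓛_v}(K, 𝐃_E) = 0` from the cotorsion of `X_ac^∅`
  obtain ⟨hSel, -⟩ := hasCorank_fullAtSelmer_zero_of_xAc S (W.baseChange K) hS κ ρ₀ hρ₀ hKc hv hvbar hne
    hgood hXfin hXtor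
  -- SUR(`𝐃_E`, `𝓛_v`): the `σ`-supply on `S` by class field theory above `p` and Brink at the split `Sf`
  have hsup : ∀ w : HeightOneSpectrum (𝓞 K), w ∈ S →
      ∃ σ : absoluteGaloisGroup (Place.Completion (Sum.inr w : Place K)), κ (absGaloisRestrict K _ σ) ≠ 1 := by
    intro w hw
    rw [hSdef, Finset.coe_insert, Finset.coe_insert] at hw
    rcases hw with rfl | rfl | hw
    · exact exists_local_apply_ne_one_of_mem_or hK hp hH κ hκ _ (Or.inl hv)
    · exact exists_local_apply_ne_one_of_mem_or hK hp hH κ hκ _ (Or.inl hvbar)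
    · exact exists_local_apply_ne_one_of_mem_or hK hp hH κ hκ w (Or.inr ((hSf w).mp (Finset.mem_coe.mp hw)).1)
  have hSUR := primaryTorsion_fullAt_SUR (W.baseChange K) hS κ ρ₀ h263 h41 h42 h5A h32 (Finset.finite_toSet _)
    hK hsup hne hv hvbar hSel
  -- the Shapiro descent with `ψ = id`
  let ψ : PrimaryTorsion (W.baseChange K).geomPoints p ≃+ (W.baseChange K).geomPrimaryTorsion p :=
    AddEquiv.refl _
  have hψ : ∀ (σ : absoluteGaloisGroup K) (x : PrimaryTorsion (W.baseChange K).geomPoints p),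
      ψ (ρ₀ (toUnramifiedQuot K S σ) x) = σ • ψ x := fun σ x ↦ by rw [hρ₀]; rfl
  have hA : ∀ x : PrimaryTorsion (W.baseChange K).geomPoints p, ∃ k : ℕ, p ^ k • x = 0 := fun x ↦ by
    obtain ⟨k, hk⟩ := x.exists_pow_smul_eq_zero
    exact ⟨k, PrimaryTorsion.ext (by rw [PrimaryTorsion.val_nsmul]; exact hk)⟩
  obtain ⟨F, hF⟩ := exists_shapiroDescent S hS κ ρ₀ ψ hψ
  -- representatives `γ^i`
  have hσrep : ∀ w ∈ Sf, ∀ i : ℕ, i < p ^ a w →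
      (κ ((fun (_ : HeightOneSpectrum (𝓞 K)) (i : ℕ) ↦ γ ^ i) w i)).toAdd = (i : ℤ_[p]) := fun w _ i _ ↦ by
    change (κ (γ ^ i)).toAdd = (i : ℤ_[p])
    rw [map_pow, show κ γ = Multiplicative.ofAdd 1 from hγ.out, ← ofAdd_nsmul, toAdd_ofAdd, nsmul_one]
  have hSfv : ∀ w ∈ Sf, w ≠ v := fun w hw h ↦ ((hSf w).mp hw).2 (h ▸ hv)
  obtain ⟨u, hunr, haway, hev⟩ := exists_mem_unramifiedOutside_forall_resOfLe_conjH1_eq_of_SUR S hS κ ρ₀ ψ hψ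
    hv hSUR hA hF Sf hSfS hSfv a (fun w hw ↦ (ha w hw).2) (fun w hw ↦ (ha w hw).1) (fun _ i ↦ γ ^ i) hσrep y
  refine ⟨u, ?_, fun w hw i hi ↦ hev w hw i hi⟩
  -- `u ∈ Sel_v̄^{Sf}`: unramified outside `Sf`, strict (= locally trivial) at `v̄`, no condition at `v`
  have hmem : u ∈ datumStrictSelmer κ.kerSubgroup ((W.baseChange K).geomPrimaryTorsion p) p
      (bdpData ((W.baseChange K).geomPrimaryTorsion p) p vbar) (↑Sf : Set (HeightOneSpectrum (𝓞 K))) := by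
    refine (mem_datumStrictSelmer_iff u).2 ⟨hunr, fun w hw σ ↦ ?_⟩
    by_cases hwv : w = vbar
    · subst hwv
      rw [bdpData_self p w hw, BigGaloisRep.strictKer_strictDatum_eq_awayKer]
      exact haway w (hS w hw) hne (fun h ↦ ((hSf w).mp h).2 hw) σ
    · rw [bdpData_of_ne p vbar hw hwv, strictKer_relaxedDatum_eq_top]
      exact AddSubgroup.mem_top _
  exact IndexPlumbingDictionary.datumStrictSelmer_le_selmerAc (W.baseChange K) p κ vbar
    (↑Sf : Set (HeightOneSpectrum (𝓞 K))) hKc hvbar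
    (fun w hw hpw ↦ hgoodN w (fun h ↦ hw (Finset.mem_coe.mpr h)) hpw) hmem

end Summit.BirchSwinnertonDyer.BirchSwinnertonDyer.Theorems.CurveRelaxationLocSurj

end
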